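import Mathlib.Algebra.BigOperators.Fin
import Mathlib.Data.Nat.Log
import Mathlib.Data.Fintype.BigOperators
import Mathlib.Data.Fin.Tuple.Basic
import Literature.Computability.Complexity.CircuitClassesProofs
import Literature.Computability.MetaComplexity.TruthTables
import Literature.Computability.MetaComplexity.NaturalProofs
import HarnessLib

/-!
# The Goldreich–Goldwasser–Micali tree and the Razborov–Rudich hybrid argument (trunk CplxMeta)

The finite, combinatorial core of the proof of the natural proofs barrier (Razborov–Rudich 1997,
Thm. 4.1), in the straight-line `B₂`-circuit model of `CplxCore` (`Circuit`, `CktSize`,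
`circuitSizeOver`, `prgHardness`). It is used by
`Literature/Computability/Complexity/PNPNaturalProofsProofs.lean` to discharge the named fact
`Literature.Computability.Complexity.natural_proofs_barrier`; everything here is about one seed length `k` and one tree
depth `n` — no asymptotics.

Given the two halves `g b : σ → σ` (`b : Bool`) of a length-doubling generator
`G₂ : {0,1}ᵏ → {0,1}²ᵏ` (`σ = {0,1}ᵏ`, `halfGen`), the GGM tree with root label `x` labels the
child `b` of a node labelled `s` by `g b s`, and the pseudo-random function `f_x : {0,1}ⁿ → {0,1}`
reads bit `0` of the label of the leaf `y` (Goldreich–Goldwasser–Micali 1986; Arora–Barak 2009,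
Thm. 9.17 with eq. (9.10) and Fig. 9.2, p. 227; Müller–Pich 2020, §3.6, p. 27:
"`G(x, y) := bit(0, G_{y_{m-1}} ∘ ⋯ ∘ G_{y_0}(x))`").

## Contents

* `nodeIdx`, `depthOf`, `pathOf`: heap numbering of the nodes of the binary tree (parents before
  children), so that "the first `i` nodes are re-randomised" makes sense.
* `ggmLab`, `hybLab`, `distLab`: the GGM tree; the `i`-th hybrid tree, in which the nodes numbered
  `< i` hand out fresh labels to their children (Arora–Barak 2009, p. 228, oracles `𝒪ᵢ`;
  Müller–Pich 2020, proof of Thm. 3.27); and the distinguisher tree, in which moreover the two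
  children of node `i` carry a challenge `z : Bool → σ`. Bookkeeping: `hybLab 0 = ggmLab`
  (`hybLab_zero_eq_ggmLab`), hybrid `i + 1` is the distinguisher tree at `i` with a fresh
  challenge (`hybLab_succ_eq_distLab`), hybrid `i` is the distinguisher tree at `i` with challenge
  `(g 0 s, g 1 s)`, `s` the label of node `i` (`hybLab_eq_distLab`), and the locality lemmas
  saying which fresh labels the distinguisher tree reads (`distLab_congr_rho`,
  `distLab_root_congr`, `distLab_congr_seed`).
* `card_rerandomize`, `card_filter_comp_mul_card`: the two counting principles of the argument
  (re-randomising an unread coordinate does not change a count; equidistributed maps preserve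
  densities).
* `Sample`, `hybCount`, `hybCount_zero`, `hybCount_last_mul`, `card_mul_hybCount_succ`,
  `card_mul_hybCount_self`, `exists_distinguisher`: the hybrid argument with exact counts over the
  sample space of all fresh labels — if a test `T` on truth tables rejects every `f_x` and accepts
  at least a `B`-fraction of all Boolean functions, then some hybrid step `i`, at some fixing `ω`
  of the fresh labels, tells `z` uniform apart from `z = (g 0 s, g 1 s)`, `s` uniform, with
  advantage `≥ B / (2ⁿ - 1)` (Razborov–Rudich 1997, proof of Thm. 4.1; Müller–Pich 2020,
  Claim 3.28; Arora–Barak 2009, p. 228).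
* `cktSize_ggmLab`, `circuitSizeOver_ggm_le`: `f_x` has `B₂`-circuits of size
  `n (2 k sb + 4 k) + 2` if every output bit of `G₂` has circuits of size `sb`
  (Arora–Barak 2009, p. 592: "the map `x ↦ g(x)` is computable by a circuit of size `poly(m)`
  that has `s` hard-wired into it").
* `cktSize_distLab`, `cktSize_distTest`: the distinguisher `z ↦ T(truth table of the
  distinguisher tree)` has `B₂`-circuits of size `k + 2ⁿ⁺¹ k (sb + 1) + |T|` (Müller–Pich 2020,
  p. 27: "the events in (34) are defined by circuits of size `2^{em+1}`").
* `halfEquiv`, `splitEquiv`, `halfGen`, `prgHardness_le_of_test`: assembled — `H(G₂) ≤ S`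
  whenever `S ≥ k + 2ⁿ⁺¹ k (sb + 1) + |T|` and `1/S ≤ B / (2ⁿ - 1)`.

## Design choices

* Paths are `p : Fin d → Bool` with `p 0` the LAST step, so that `Fin.tail p` is the parent and
  all tree recursions are structural in `d`.
* The sample space of the hybrid argument is `Sample σ n = σ × (Fin (2ⁿ) → Bool → σ)`: a root
  label and a pair of fresh labels for the children of every node number `< 2ⁿ` (only internal
  nodes, numbered `< 2ⁿ - 1`, are ever read; `Sample.rho` extends by a junk `default`).
  Probabilities are exact counts (`Finset.card`), turned into real densities only in
  `exists_distinguisher` and `prgHardness_le_of_test`.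
* Uniformity of the last hybrid (`hybCount_last_mul`) is proved by a bit-flip involution on
  samples (`flipAt`); this needs a readout `o : σ → Bool` together with an involution `flip` of
  `σ` negating `o` (for `σ = {0,1}ᵏ⁺¹`: `o = (· 0)`, `flip` negates coordinate `0`).
* No asymptotic notions appear; the caller chooses `n = ⌊k^{1/D}⌋` and does the `2^{O(n)}`
  versus `2^{k^ε}` comparison.

Mathlib has no GGM construction or hybrid argument (grep `Goldwasser`, `hybrid argument`,
`pseudorandom function`: nothing); the probabilistic-model PRF notions of
`Literature/Computability/Cryptography/PseudorandomFunctions.lean` (oracle machines, `PMF`) are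
unrelated to the circuit model used here. Everything lives in `namespace Literature.CplxMeta`.

## References

* A. A. Razborov, S. Rudich, *Natural proofs*, J. Comput. System Sci. 55 (1997) 24–35, Thm. 4.1
  and its proof.
* O. Goldreich, S. Goldwasser, S. Micali, *How to construct random functions*, J. ACM 33 (1986)
  792–807, §3.
* S. Arora, B. Barak, *Computational Complexity: A Modern Approach*, CUP 2009: Thm. 9.17 with
  eq. (9.10) and Fig. 9.2 (p. 227) and its proof by the hybrid argument (p. 228); §23.3, proof of
  Thm. 23.1 (pp. 591–592).
* M. Müller, J. Pich, *Feasibly constructive proofs of succinct weak circuit lower bounds*,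
  Ann. Pure Appl. Logic 171 (2020) 102735, §3.6, Thm. 3.27 and Claim 3.28 (p. 27).
-/

namespace Literature.Computability.MetaComplexity

open Complexity Finset

/-! ### Heap numbering of the nodes of the binary tree -/

/-- The node of the infinite binary tree at depth `d` reached by the path `q : Fin d → Bool` gets
the number `2 ^ d - 1 + #q`, where `#q < 2 ^ d` is the rank of `q` in the enumeration
`boolFunEquivFin d` (heap numbering shifted to start at `0`: the root is `0`, the depth-`d` nodes
occupy `[2 ^ d - 1, 2 ^ (d + 1) - 1)`). Parents precede children. [folklore] -/
def nodeIdx (d : ℕ) (q : Fin d → Bool) : ℕ := 2 ^ d - 1 + (boolFunEquivFin d q : ℕ)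

variable {d : ℕ}

/-- Depth-`d` nodes are numbered `≥ 2 ^ d - 1`. [folklore] -/
theorem le_nodeIdx (q : Fin d → Bool) : 2 ^ d - 1 ≤ nodeIdx d q := Nat.le_add_right _ _

/-- Depth-`d` nodes are numbered `< 2 ^ (d + 1) - 1`. [folklore] -/
theorem nodeIdx_lt (q : Fin d → Bool) : nodeIdx d q < 2 ^ (d + 1) - 1 := by
  have h := (boolFunEquivFin d q).isLt
  have h1 : 1 ≤ 2 ^ d := Nat.one_le_two_pow
  unfold nodeIdx
  rw [pow_succ]
  omega

/-- Depth-`d` nodes are numbered `< 2 ^ (d + 1) - 1` (successor form). [folklore] -/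
theorem nodeIdx_succ_lt (q : Fin d → Bool) : nodeIdx d q + 1 < 2 ^ (d + 1) := by
  have := nodeIdx_lt q
  have h1 : 1 ≤ 2 ^ (d + 1) := Nat.one_le_two_pow
  omega

/-- Depth-`m` nodes are numbered `< 2 ^ (m + 1)`. [folklore] -/
theorem nodeIdx_lt_two_pow {m : ℕ} (q : Fin m → Bool) : nodeIdx m q < 2 ^ (m + 1) := by
  have := nodeIdx_lt q; omega

/-- The numbering is injective on each depth. [folklore] -/
theorem nodeIdx_injective (d : ℕ) : Function.Injective (nodeIdx d) := by
  intro q q' h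
  unfold nodeIdx at h
  exact (boolFunEquivFin d).injective (Fin.ext (by omega))

/-- Nodes with the same number have the same depth. [folklore] -/
theorem depth_eq_of_nodeIdx_eq {d d' : ℕ} {q : Fin d → Bool} {q' : Fin d' → Bool}
    (h : nodeIdx d q = nodeIdx d' q') : d = d' := by
  by_contra hne
  rcases Nat.lt_or_gt_of_ne hne with hlt | hlt
  · have h1 := nodeIdx_lt q
    have h2 := le_nodeIdx q'
    have h3 : 2 ^ (d + 1) ≤ 2 ^ d' := Nat.pow_le_pow_right (by norm_num) hlt
    omega
  · have h1 := nodeIdx_lt q'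
    have h2 := le_nodeIdx q
    have h3 : 2 ^ (d' + 1) ≤ 2 ^ d := Nat.pow_le_pow_right (by norm_num) hlt
    omega

/-- The parent `Fin.tail p` of a node `p` has a smaller number. [folklore] -/
theorem nodeIdx_tail_lt (p : Fin (d + 1) → Bool) : nodeIdx d (Fin.tail p) < nodeIdx (d + 1) p :=
  lt_of_lt_of_le (nodeIdx_lt _) (le_nodeIdx p)

/-- The root has number `0`. [folklore] -/
theorem nodeIdx_zero (q : Fin 0 → Bool) : nodeIdx 0 q = 0 := by
  simp [nodeIdx]

/-- Non-root nodes have nonzero numbers. [folklore] -/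
theorem nodeIdx_ne_zero (p : Fin (d + 1) → Bool) : nodeIdx (d + 1) p ≠ 0 :=
  Nat.ne_of_gt (lt_of_le_of_lt (Nat.zero_le _) (nodeIdx_tail_lt p))

/-- Depth of the node with number `i`: `⌊log₂ (i + 1)⌋`. [folklore] -/
def depthOf (i : ℕ) : ℕ := Nat.log 2 (i + 1)

/-- `2 ^ depthOf i ≤ i + 1`. [folklore] -/
theorem two_pow_depthOf_le (i : ℕ) : 2 ^ depthOf i ≤ i + 1 :=
  Nat.pow_log_le_self 2 (Nat.succ_ne_zero i)

/-- `i + 1 < 2 ^ (depthOf i + 1)`. [folklore] -/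
theorem lt_two_pow_depthOf_succ (i : ℕ) : i + 1 < 2 ^ (depthOf i + 1) :=
  Nat.lt_pow_succ_log_self (by norm_num) (i + 1)

/-- Path (from the root) of the node with number `i`. [folklore] -/
def pathOf (i : ℕ) : Fin (depthOf i) → Bool :=
  (boolFunEquivFin (depthOf i)).symm ⟨i + 1 - 2 ^ depthOf i, by
    have h1 := two_pow_depthOf_le i
    have h2 := lt_two_pow_depthOf_succ i
    rw [pow_succ] at h2
    omega⟩

/-- `(depthOf i, pathOf i)` is the node with number `i`. [folklore] -/
@[simp] theorem nodeIdx_pathOf (i : ℕ) : nodeIdx (depthOf i) (pathOf i) = i := by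
  have h1 := two_pow_depthOf_le i
  have h3 : 1 ≤ 2 ^ depthOf i := Nat.one_le_two_pow
  simp only [nodeIdx, pathOf, Equiv.apply_symm_apply]
  omega

/-- Nodes numbered `< 2 ^ n - 1` (the internal nodes of the depth-`n` tree) have depth `< n`.
[folklore] -/
theorem depthOf_lt_of_lt {i n : ℕ} (h : i < 2 ^ n - 1) : depthOf i < n := by
  have h1 := two_pow_depthOf_le i
  refine lt_of_not_ge fun hle => ?_
  have h2 : 2 ^ n ≤ 2 ^ depthOf i := Nat.pow_le_pow_right (by norm_num) hle
  omega

/-- `depthOf` inverts `nodeIdx` on the depth component. [folklore] -/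
theorem depthOf_nodeIdx (q : Fin d → Bool) : depthOf (nodeIdx d q) = d :=
  depth_eq_of_nodeIdx_eq (nodeIdx_pathOf (nodeIdx d q))

/-! ### GGM trees, hybrid trees, distinguisher trees -/

section Trees

variable {σ : Type*} (g : Bool → σ → σ) (ρ : ℕ → Bool → σ) (x : σ)

/-- The GGM tree (Goldreich–Goldwasser–Micali): root label `x`, and the child `b` of a node
labelled `s` is labelled `g b s`; `ggmLab g x d p` is the label of the depth-`d` node with path
`p` (`p 0` is the last step), i.e. `g (p 0) (g (p 1) (⋯ (g (p (d-1)) x)))` (Arora–Barak 2009,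
Thm. 9.17, eq. (9.10) and Fig. 9.2, p. 227; Müller–Pich 2020, p. 27).
[cite: AroraBarakCC2009, Thm. 9.17 eq. (9.10) p. 227] -/
def ggmLab : (d : ℕ) → (Fin d → Bool) → σ
  | 0, _ => x
  | d + 1, p => g (p 0) (ggmLab d (Fin.tail p))

/-- The `i`-th hybrid tree: nodes numbered `< i` hand out the fresh labels `ρ j b` to their
children `b`, the other nodes apply `g` as in the GGM tree (Arora–Barak 2009, proof of Thm. 9.17,
p. 228, the oracles `𝒪ᵢ`; Razborov–Rudich 1997, proof of Thm. 4.1; Müller–Pich 2020, proof of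
Thm. 3.27, p. 27). [cite: AroraBarakCC2009, proof of Thm. 9.17 p. 228] -/
def hybLab (i : ℕ) : (d : ℕ) → (Fin d → Bool) → σ
  | 0, _ => x
  | d + 1, p =>
    if nodeIdx d (Fin.tail p) < i then ρ (nodeIdx d (Fin.tail p)) (p 0)
    else g (p 0) (hybLab i d (Fin.tail p))

/-- The distinguisher tree at `i` with challenge `z : Bool → σ`: as the `i`-th hybrid tree, except
that the two children of node number `i` are labelled by the challenge, `z 0` and `z 1`
(Arora–Barak 2009, proof of Thm. 9.17, p. 228, algorithm `B`: "in the `i`th invocation use the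
value `y` instead of the result of invoking `G`"; Müller–Pich 2020, proof of Thm. 3.27, p. 27).
[cite: AroraBarakCC2009, proof of Thm. 9.17 p. 228] -/
def distLab (i : ℕ) (z : Bool → σ) : (d : ℕ) → (Fin d → Bool) → σ
  | 0, _ => x
  | d + 1, p =>
    if nodeIdx d (Fin.tail p) < i then ρ (nodeIdx d (Fin.tail p)) (p 0)
    else if nodeIdx d (Fin.tail p) = i then z (p 0)
    else g (p 0) (distLab i z d (Fin.tail p))

variable {g ρ x}

/-- The root of the GGM tree is labelled `x`. [folklore] -/
@[simp] theorem ggmLab_zero (p : Fin 0 → Bool) : ggmLab g x 0 p = x := rfl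

/-- One step down the GGM tree. [folklore] -/
@[simp] theorem ggmLab_succ (p : Fin (d + 1) → Bool) :
    ggmLab g x (d + 1) p = g (p 0) (ggmLab g x d (Fin.tail p)) := rfl

/-- The root of every hybrid tree is labelled `x`. [folklore] -/
@[simp] theorem hybLab_zero' (i : ℕ) (p : Fin 0 → Bool) : hybLab g ρ x i 0 p = x := rfl

/-- One step down a hybrid tree (definitional unfolding). [folklore] -/
theorem hybLab_succ (i : ℕ) (p : Fin (d + 1) → Bool) :
    hybLab g ρ x i (d + 1) p = if nodeIdx d (Fin.tail p) < i then ρ (nodeIdx d (Fin.tail p)) (p 0)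
      else g (p 0) (hybLab g ρ x i d (Fin.tail p)) := rfl

/-- The root of every distinguisher tree is labelled `x`. [folklore] -/
@[simp] theorem distLab_zero' (i : ℕ) (z : Bool → σ) (p : Fin 0 → Bool) :
    distLab g ρ x i z 0 p = x := rfl

/-- One step down a distinguisher tree (definitional unfolding). [folklore] -/
theorem distLab_succ (i : ℕ) (z : Bool → σ) (p : Fin (d + 1) → Bool) :
    distLab g ρ x i z (d + 1) p =
      if nodeIdx d (Fin.tail p) < i then ρ (nodeIdx d (Fin.tail p)) (p 0)
      else if nodeIdx d (Fin.tail p) = i then z (p 0)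
      else g (p 0) (distLab g ρ x i z d (Fin.tail p)) := rfl

/-- Hybrid `0` is the GGM tree (Arora–Barak 2009, p. 228: "`𝒪₀` is the same as the oracle `𝒪` to
`f_{Uₙ}`"). [cite: AroraBarakCC2009, proof of Thm. 9.17 p. 228] -/
theorem hybLab_zero_eq_ggmLab : ∀ (d : ℕ) (p : Fin d → Bool), hybLab g ρ x 0 d p = ggmLab g x d p
  | 0, _ => rfl
  | d + 1, p => by simp [hybLab_succ, hybLab_zero_eq_ggmLab d]

/-- In hybrid `i`, a child of a node numbered `< i` carries a fresh label. [folklore] -/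
theorem hybLab_of_lt {i : ℕ} (p : Fin (d + 1) → Bool) (h : nodeIdx d (Fin.tail p) < i) :
    hybLab g ρ x i (d + 1) p = ρ (nodeIdx d (Fin.tail p)) (p 0) := by
  simp [hybLab_succ, h]

/-- In the last hybrid (`i ≥ 2 ^ n - 1`) every node of depth `≤ n` other than the root carries a
fresh label (Arora–Barak 2009, p. 228: "`𝒪_{nT}` is an oracle to a completely random function").
[cite: AroraBarakCC2009, proof of Thm. 9.17 p. 228] -/
theorem hybLab_last {n i : ℕ} (hi : 2 ^ n - 1 ≤ i) (hd : d < n) (p : Fin (d + 1) → Bool) :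
    hybLab g ρ x i (d + 1) p = ρ (nodeIdx d (Fin.tail p)) (p 0) := by
  apply hybLab_of_lt
  have h1 := nodeIdx_lt (Fin.tail p)
  have h2 : 2 ^ (d + 1) ≤ 2 ^ n := Nat.pow_le_pow_right (by norm_num) hd
  omega

/-- Hybrid `i + 1` is the distinguisher tree at `i` fed with the fresh challenge `ρ i`
(Arora–Barak 2009, p. 228: "if the input `y` is distributed as `U₂ₙ`, then `B`'s output is
distributed as `A^{𝒪ᵢ}`"). [cite: AroraBarakCC2009, proof of Thm. 9.17 p. 228] -/
theorem hybLab_succ_eq_distLab (i : ℕ) :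
    ∀ (d : ℕ) (p : Fin d → Bool), hybLab g ρ x (i + 1) d p = distLab g ρ x i (ρ i) d p
  | 0, _ => rfl
  | d + 1, p => by
    rw [hybLab_succ, distLab_succ]
    rcases Nat.lt_trichotomy (nodeIdx d (Fin.tail p)) i with h | h | h
    · simp [h, Nat.lt_succ_of_lt h]
    · simp [h]
    · have h1 : ¬ nodeIdx d (Fin.tail p) < i + 1 := by omega
      have h2 : ¬ nodeIdx d (Fin.tail p) < i := by omega
      simp [h1, h2, Nat.ne_of_gt h, hybLab_succ_eq_distLab i d]

/-- Hybrid `i` is the distinguisher tree at `i` fed with the pseudo-random challenge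
`b ↦ g b s`, where `s` is the label of node `i = (D, q)` in hybrid `i` (Arora–Barak 2009, p. 228:
"if it is distributed according to `G(Uₙ)`, `B`'s output is distributed as `A^{𝒪ᵢ₋₁}`").
[cite: AroraBarakCC2009, proof of Thm. 9.17 p. 228] -/
theorem hybLab_eq_distLab {D : ℕ} (q : Fin D → Bool) :
    ∀ (d : ℕ) (p : Fin d → Bool), hybLab g ρ x (nodeIdx D q) d p =
      distLab g ρ x (nodeIdx D q) (fun b => g b (hybLab g ρ x (nodeIdx D q) D q)) d p
  | 0, _ => rfl
  | d + 1, p => by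
    rw [hybLab_succ, distLab_succ]
    by_cases h : nodeIdx d (Fin.tail p) < nodeIdx D q
    · simp [h]
    · simp only [h, ↓reduceIte]
      by_cases he : nodeIdx d (Fin.tail p) = nodeIdx D q
      · simp only [he, ↓reduceIte]
        obtain rfl : d = D := depth_eq_of_nodeIdx_eq he
        rw [nodeIdx_injective d he]
      · simp only [he, ↓reduceIte]
        rw [hybLab_eq_distLab q d]

/-- The distinguisher tree at `i` reads the fresh labels `ρ j` only for `j < i`. [folklore] -/
theorem distLab_congr_rho {ρ' : ℕ → Bool → σ} {i : ℕ} (h : ∀ j < i, ρ' j = ρ j) (z : Bool → σ) :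
    ∀ (d : ℕ) (p : Fin d → Bool), distLab g ρ' x i z d p = distLab g ρ x i z d p
  | 0, _ => rfl
  | d + 1, p => by
    rw [distLab_succ, distLab_succ]
    by_cases h1 : nodeIdx d (Fin.tail p) < i
    · simp [h1, h _ h1]
    · simp [h1, distLab_congr_rho h z d]

/-- The distinguisher tree at the root (`i = 0`) does not read the root label below the root.
[folklore] -/
theorem distLab_root_congr {x' : σ} (z : Bool → σ) :
    ∀ (d : ℕ) (p : Fin (d + 1) → Bool), distLab g ρ x' 0 z (d + 1) p = distLab g ρ x 0 z (d + 1) p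
  | 0, p => by simp [distLab_succ, nodeIdx_zero]
  | d + 1, p => by
    have ih := distLab_root_congr (x' := x') z d (Fin.tail p)
    simp only [distLab_succ (d := d + 1), nodeIdx_ne_zero, Nat.not_lt_zero, if_false, ih]

/-- Away from node `i = (D + 1, q)` itself, the distinguisher tree at `i` does not read the fresh
label `ρ (parent of i) (q 0)` which node `i` carries in hybrid `i`. [folklore] -/
theorem distLab_congr_seed {D : ℕ} (q : Fin (D + 1) → Bool) {ρ' : ℕ → Bool → σ}
    (h : ∀ j b, (j ≠ nodeIdx D (Fin.tail q) ∨ b ≠ q 0) → ρ' j b = ρ j b) (z : Bool → σ) :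
    ∀ (d : ℕ) (p : Fin d → Bool), nodeIdx d p ≠ nodeIdx (D + 1) q →
      distLab g ρ' x (nodeIdx (D + 1) q) z d p = distLab g ρ x (nodeIdx (D + 1) q) z d p
  | 0, _, _ => rfl
  | d + 1, p, hp => by
    rw [distLab_succ, distLab_succ]
    by_cases h1 : nodeIdx d (Fin.tail p) < nodeIdx (D + 1) q
    · simp only [h1, ↓reduceIte]
      refine h _ _ (not_and_or.mp fun ⟨hj, hb⟩ => ?_)
      obtain rfl : d = D := depth_eq_of_nodeIdx_eq hj
      have ht : Fin.tail p = Fin.tail q := nodeIdx_injective d hj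
      apply hp
      rw [← Fin.cons_self_tail p, ← Fin.cons_self_tail q, ht, hb]
    · simp only [h1, ↓reduceIte]
      by_cases h2 : nodeIdx d (Fin.tail p) = nodeIdx (D + 1) q
      · simp [h2]
      · simp only [h2, ↓reduceIte]
        rw [distLab_congr_seed q h z d (Fin.tail p) h2]

end Trees

/-! ### Two counting principles -/

section Counting

/-- **Re-randomising an unread coordinate.** If `get/set` present `Ω` as a product `Ω' × S`
(lens laws) and the event `D ω s` does not read the `S`-coordinate of `ω`, then feeding the
coordinate itself as `s` has the same count as feeding an independent uniform `s`:
`|S| · #{ω | D ω (get ω)} = #{(ω, s) | D ω s}` (the bijection `(ω, s) ↦ (set ω s, get ω)` of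
`Ω × S`). [folklore] -/
theorem card_rerandomize {Ω S : Type*} [Fintype Ω] [Fintype S]
    (get : Ω → S) (set : Ω → S → Ω)
    (get_set : ∀ ω s, get (set ω s) = s) (set_set : ∀ ω s s', set (set ω s) s' = set ω s')
    (set_get : ∀ ω, set ω (get ω) = ω)
    (D : Ω → S → Bool) (hD : ∀ ω s s', D (set ω s) s' = D ω s') :
    Fintype.card S * #{ω : Ω | D ω (get ω) = true} = #{p : Ω × S | D p.1 p.2 = true} := by
  let Φ : Ω × S ≃ Ω × S :=
    { toFun := fun p => (set p.1 p.2, get p.1)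
      invFun := fun p => (set p.1 p.2, get p.1)
      left_inv := fun p => by simp [set_set, set_get, get_set]
      right_inv := fun p => by simp [set_set, set_get, get_set] }
  have h1 : #{p : Ω × S | D p.1 (get p.1) = true} =
      Fintype.card S * #{ω : Ω | D ω (get ω) = true} := by
    rw [show ({p : Ω × S | D p.1 (get p.1) = true} : Finset (Ω × S)) =
        ({ω : Ω | D ω (get ω) = true} : Finset Ω) ×ˢ (univ : Finset S) from ?_]
    · rw [card_product, card_univ, mul_comm]
    · ext ⟨ω, s⟩
      simp
  rw [← h1]
  exact card_equiv Φ fun ⟨ω, s⟩ => by simp [Φ, hD]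

/-- **Equidistributed maps preserve densities.** If all fibres of `Ψ : Ω → H` have the same size,
then `#{ω | T (Ψ ω)} · |H| = |Ω| · #{h | T h}`. [folklore] -/
theorem card_filter_comp_mul_card {Ω H : Type*} [Fintype Ω] [Fintype H] [DecidableEq H]
    (Ψ : Ω → H) (hΨ : ∀ h h', #{ω : Ω | Ψ ω = h} = #{ω : Ω | Ψ ω = h'}) (T : H → Bool) :
    #{ω : Ω | T (Ψ ω) = true} * Fintype.card H = Fintype.card Ω * #{h : H | T h = true} := by
  rcases isEmpty_or_nonempty H with hH | ⟨⟨h₀⟩⟩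
  · have : IsEmpty Ω := ⟨fun ω => isEmptyElim (Ψ ω)⟩
    simp
  · have hs : #{ω : Ω | T (Ψ ω) = true} = #{h : H | T h = true} * #{ω : Ω | Ψ ω = h₀} := by
      rw [card_eq_sum_card_fiberwise (f := Ψ) (t := ({h : H | T h = true} : Finset H))
        (fun ω hω => by simpa using hω)]
      rw [Finset.sum_congr rfl (g := fun _ => #{ω : Ω | Ψ ω = h₀}), sum_const, smul_eq_mul]
      intro h hh
      simp only [Finset.mem_filter, Finset.mem_univ, true_and] at hh
      rw [← hΨ h h₀]
      congr 1
      ext ω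
      simp only [Finset.mem_filter, Finset.mem_univ, true_and, and_iff_right_iff_imp]
      rintro rfl
      exact hh
    have hu : Fintype.card Ω = Fintype.card H * #{ω : Ω | Ψ ω = h₀} := by
      rw [← card_univ, card_eq_sum_card_fiberwise (f := Ψ) (t := (univ : Finset H))
        (fun ω _ => mem_univ _)]
      rw [Finset.sum_congr rfl (g := fun _ => #{ω : Ω | Ψ ω = h₀}) (fun h _ => by
        simpa using hΨ h h₀), sum_const, smul_eq_mul, card_univ]
    rw [hs, hu]
    ring

/-- A filtered product counts fibrewise: `#{(ω, s) | D ω s} = Σ_ω #{s | D ω s}`. [folklore] -/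
theorem card_filter_prod_eq_sum {Ω S : Type*} [Fintype Ω] [Fintype S] (D : Ω → S → Bool) :
    #{p : Ω × S | D p.1 p.2 = true} = ∑ ω, #{s : S | D ω s = true} := by
  rw [card_filter, ← univ_product_univ, sum_product]
  simp only [card_filter]

end Counting

/-! ### The hybrid argument over the sample space of fresh labels -/

section Hybrid

variable {σ : Type*} {n m : ℕ}

/-- The sample space of the hybrid argument for trees of depth `n` over the label type `σ`: a root
label and a pair of fresh labels for (the children of) every node number `< 2 ^ n`; all internal
nodes have numbers `< 2 ^ n - 1` (Arora–Barak 2009, p. 228: "`𝒪ᵢ` chooses both `y₀` and `y₁`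
independently at random"; Müller–Pich 2020, proof of Thm. 3.27, the assignments `a`).
[cite: AroraBarakCC2009, proof of Thm. 9.17 p. 228] -/
abbrev Sample (σ : Type*) (n : ℕ) : Type _ := σ × (Fin (2 ^ n) → Bool → σ)

/-- The fresh labels of a sample as a total function on node numbers (junk value `default` at
numbers `≥ 2 ^ n`, which are never read). [folklore] -/
def Sample.rho [Inhabited σ] (ω : Sample σ n) : ℕ → Bool → σ := fun j b =>
  if h : j < 2 ^ n then ω.2 ⟨j, h⟩ b else default

/-- `Sample.rho` below `2 ^ n` is the stored fresh label. [folklore] -/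
theorem Sample.rho_of_lt [Inhabited σ] (ω : Sample σ n) {j : ℕ} (h : j < 2 ^ n) (b : Bool) :
    Sample.rho ω j b = ω.2 ⟨j, h⟩ b := dif_pos h

variable (g : Bool → σ → σ) (o : σ → Bool)

/-- The Boolean function at the leaves of hybrid `i`: leaf `y` reads `o` of its label (for the
GGM tree, `o = bit 0`: Müller–Pich 2020, p. 27, "`G(x, y) := bit(0, …)`").
[cite: MullerPich2020, §3.6 proof of Thm. 3.27 p. 27] -/
def hybFun [Inhabited σ] (ω : Sample σ n) (i : ℕ) : (Fin n → Bool) → Bool :=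
  fun y => o (hybLab g ω.rho ω.1 i n y)

/-- The Boolean function at the leaves of the distinguisher tree at `i` with challenge `z`.
[cite: MullerPich2020, §3.6 proof of Thm. 3.27 p. 27] -/
def distFun [Inhabited σ] (ω : Sample σ n) (i : ℕ) (z : Bool → σ) : (Fin n → Bool) → Bool :=
  fun y => o (distLab g ω.rho ω.1 i z n y)

variable (T : ((Fin n → Bool) → Bool) → Bool)

/-- The number of samples whose hybrid-`i` function passes the test `T` (the numerator of
Arora–Barak's `pᵢ = Pr[A^{𝒪ᵢ} = 1]`, p. 228). [cite: AroraBarakCC2009, proof of Thm. 9.17 p. 228] -/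
def hybCount [Fintype σ] [Inhabited σ] (i : ℕ) : ℕ := #{ω : Sample σ n | T (hybFun g o ω i) = true}

variable {g o T}

/-- Hybrid `0` is the GGM tree, on which the test is assumed to fail always, so `hybCount 0 = 0`.
[cite: AroraBarakCC2009, proof of Thm. 9.17 p. 228] -/
theorem hybCount_zero [Fintype σ] [Inhabited σ]
    (hA : ∀ x : σ, T (fun y => o (ggmLab g x n y)) = false) :
    hybCount g o T 0 = 0 := by
  simp only [hybCount, Finset.card_eq_zero, Finset.filter_eq_empty_iff, Finset.mem_univ,
    true_implies, Bool.not_eq_true]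
  intro ω
  have : hybFun g o ω 0 = fun y => o (ggmLab g ω.1 n y) :=
    funext fun y => by simp [hybFun, hybLab_zero_eq_ggmLab]
  rw [this, hA]

/-! #### The last hybrid is a uniformly random function -/

/-- The key of a leaf `y` of the depth-`(m+1)` tree: the number of its parent, as an element of
`Fin (2 ^ (m + 1))`. [folklore] -/
def leafKey (y : Fin (m + 1) → Bool) : Fin (2 ^ (m + 1)) :=
  ⟨nodeIdx m (Fin.tail y), nodeIdx_lt_two_pow _⟩

/-- A leaf is determined by its parent and its last step. [folklore] -/
theorem eq_of_leafKey_eq {y y' : Fin (m + 1) → Bool} (h : leafKey y = leafKey y')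
    (h0 : y 0 = y' 0) : y = y' := by
  have ht : Fin.tail y = Fin.tail y' :=
    nodeIdx_injective m (by simpa [leafKey] using congrArg Fin.val h)
  rw [← Fin.cons_self_tail y, ← Fin.cons_self_tail y', ht, h0]

/-- The leaf function of the last hybrid: leaf `y` reads `o` of the fresh label
`ω.2 (parent y) (y 0)`. [folklore] -/
def lastMap (o : σ → Bool) (ω : Sample σ (m + 1)) : (Fin (m + 1) → Bool) → Bool :=
  fun y => o (ω.2 (leafKey y) (y 0))

/-- In hybrid `2 ^ (m + 1) - 1` (all internal nodes re-randomised) the leaf function is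
`lastMap`. [cite: AroraBarakCC2009, proof of Thm. 9.17 p. 228] -/
theorem hybFun_last [Inhabited σ] (ω : Sample σ (m + 1)) :
    hybFun g o ω (2 ^ (m + 1) - 1) = lastMap o ω := by
  funext y
  simp only [hybFun, lastMap]
  rw [hybLab_last (n := m + 1) le_rfl (Nat.lt_succ_self m),
    Sample.rho_of_lt ω (nodeIdx_lt_two_pow _)]
  rfl

/-- Applying `flip` to the fresh labels read by the leaves in the support of `h₀`. [folklore] -/
def flipAt (flip : σ → σ) (h₀ : (Fin (m + 1) → Bool) → Bool) (ω : Sample σ (m + 1)) :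
    Sample σ (m + 1) :=
  (ω.1, fun j b => if ∃ y, h₀ y = true ∧ leafKey y = j ∧ y 0 = b then flip (ω.2 j b) else ω.2 j b)

/-- `flipAt` is an involution when `flip` is. [folklore] -/
theorem flipAt_flipAt {flip : σ → σ} (hflip : ∀ s, flip (flip s) = s)
    (h₀ : (Fin (m + 1) → Bool) → Bool) (ω : Sample σ (m + 1)) :
    flipAt flip h₀ (flipAt flip h₀ ω) = ω := by
  obtain ⟨x, ρ⟩ := ω
  simp only [flipAt, Prod.mk.injEq, true_and]
  funext j b
  by_cases h : ∃ y, h₀ y = true ∧ leafKey y = j ∧ y 0 = b <;> simp [h, hflip]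

/-- `flipAt flip h₀` XORs the leaf function of the last hybrid with `h₀`, provided `flip`
negates the readout `o`. [folklore] -/
theorem lastMap_flipAt {flip : σ → σ} (ho : ∀ s, o (flip s) = !o s)
    (h₀ : (Fin (m + 1) → Bool) → Bool) (ω : Sample σ (m + 1)) (y : Fin (m + 1) → Bool) :
    lastMap o (flipAt flip h₀ ω) y = ((lastMap o ω y) ^^ (h₀ y)) := by
  have hiff : (∃ y', h₀ y' = true ∧ leafKey y' = leafKey y ∧ y' 0 = y 0) ↔ h₀ y = true := by
    constructor
    · rintro ⟨y', h1, h2, h3⟩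
      rwa [← eq_of_leafKey_eq h2 h3]
    · intro h
      exact ⟨y, h, rfl, rfl⟩
  simp only [lastMap, flipAt]
  by_cases h : h₀ y = true
  · rw [if_pos (hiff.mpr h), ho, h]
    simp
  · rw [if_neg (mt hiff.mp h)]
    simp only [Bool.not_eq_true] at h
    simp [h]

/-- All fibres of `lastMap o : Sample σ (m+1) → ((Fin (m+1) → Bool) → Bool)` have the same size
(the involution `flipAt flip (h ⊕ h')` exchanges the fibres over `h` and `h'`). [folklore] -/
theorem card_fiber_lastMap [Fintype σ] {flip : σ → σ} (ho : ∀ s, o (flip s) = !o s)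
    (hflip : ∀ s, flip (flip s) = s) (h h' : (Fin (m + 1) → Bool) → Bool) :
    #{ω : Sample σ (m + 1) | lastMap o ω = h} = #{ω : Sample σ (m + 1) | lastMap o ω = h'} := by
  set h₀ : (Fin (m + 1) → Bool) → Bool := fun y => (h y ^^ h' y)
  have hinv : Function.Involutive (flipAt flip h₀) := flipAt_flipAt hflip h₀
  refine card_equiv (hinv.toPerm _) fun ω => ?_
  simp only [Finset.mem_filter, Finset.mem_univ, true_and, Function.Involutive.coe_toPerm]
  constructor
  · intro hω
    funext y
    rw [lastMap_flipAt ho, hω]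
    simp only [h₀]
    cases h y <;> cases h' y <;> rfl
  · intro hω
    funext y
    have := congrFun hω y
    rw [lastMap_flipAt ho] at this
    simp only [h₀] at this
    revert this
    cases lastMap o ω y <;> cases h y <;> cases h' y <;> simp

/-- **The last hybrid is uniform**: the density of samples passing `T` in hybrid `2 ^ (m+1) - 1`
equals the density of Boolean functions passing `T` (Arora–Barak 2009, p. 228: "`𝒪_{nT}` is an
oracle to a completely random function"; Müller–Pich 2020, proof of Claim 3.28).
[cite: AroraBarakCC2009, proof of Thm. 9.17 p. 228] -/
theorem hybCount_last_mul [Fintype σ] [Inhabited σ] {flip : σ → σ} (ho : ∀ s, o (flip s) = !o s)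
    (hflip : ∀ s, flip (flip s) = s) (T : ((Fin (m + 1) → Bool) → Bool) → Bool) :
    hybCount g o T (2 ^ (m + 1) - 1) * 2 ^ 2 ^ (m + 1) =
      Fintype.card (Sample σ (m + 1)) * #{h : (Fin (m + 1) → Bool) → Bool | T h = true} := by
  have h1 : hybCount g o T (2 ^ (m + 1) - 1) =
      #{ω : Sample σ (m + 1) | T (lastMap o ω) = true} := by
    simp only [hybCount, hybFun_last]
  have h2 : Fintype.card ((Fin (m + 1) → Bool) → Bool) = 2 ^ 2 ^ (m + 1) := by simp
  rw [h1, ← h2]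
  exact card_filter_comp_mul_card (lastMap o) (card_fiber_lastMap ho hflip) T

/-! #### One hybrid step: re-randomising the challenge and the seed -/

/-- **Hybrid `i + 1` with the challenge re-randomised**:
`|Bool → σ| · hybCount (i+1) = Σ_ω #{z | T (distinguisher tree at i with challenge z)}`
(Arora–Barak 2009, p. 228: "if the input `y` is distributed as `U₂ₙ`, then `B`'s output is
distributed as `A^{𝒪ᵢ}`"). [cite: AroraBarakCC2009, proof of Thm. 9.17 p. 228] -/
theorem card_mul_hybCount_succ [Fintype σ] [Inhabited σ] {i : ℕ} (hi : i < 2 ^ n) :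
    Fintype.card (Bool → σ) * hybCount g o T (i + 1) =
      ∑ ω : Sample σ n, #{z : Bool → σ | T (distFun g o ω i z) = true} := by
  let a : Fin (2 ^ n) := ⟨i, hi⟩
  have key := card_rerandomize (Ω := Sample σ n) (S := Bool → σ) (fun ω => ω.2 a)
    (fun ω z => (ω.1, Function.update ω.2 a z))
    (fun ω z => Function.update_self a z ω.2)
    (fun ω z z' => congrArg (Prod.mk ω.1) (Function.update_idem z z' ω.2))
    (fun ω => by
      show (ω.1, Function.update ω.2 a (ω.2 a)) = ω
      rw [Function.update_eq_self])
    (fun ω z => T (distFun g o ω i z)) (fun ω z z' => by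
      show T (distFun g o (ω.1, Function.update ω.2 a z) i z') = T (distFun g o ω i z')
      congr 1
      funext y
      simp only [distFun]
      refine congrArg o (distLab_congr_rho (fun j hj => ?_) z' n y)
      funext b
      simp only [Sample.rho]
      split_ifs with h
      · rw [Function.update_of_ne]
        exact fun he => (Nat.ne_of_lt hj) (congrArg Fin.val he)
      · rfl)
  rw [← key.trans (card_filter_prod_eq_sum fun ω z => T (distFun g o ω i z))]
  congr 1
  simp only [hybCount]
  congr 1
  ext ω
  simp only [Finset.mem_filter, Finset.mem_univ, true_and]
  have : hybFun g o ω (i + 1) = distFun g o ω i (ω.2 a) := by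
    funext y
    simp only [hybFun, distFun, hybLab_succ_eq_distLab]
    congr 2
    funext b
    exact Sample.rho_of_lt ω hi b
  rw [this]

/-- **Hybrid `i` with the seed of node `i` re-randomised** (node `i = (D, q)` internal):
`|σ| · hybCount i = Σ_ω #{s | T (distinguisher tree at i with challenge (g 0 s, g 1 s))}`
(Arora–Barak 2009, p. 228: "if it is distributed according to `G(Uₙ)`, `B`'s output is
distributed as `A^{𝒪ᵢ₋₁}`"). [cite: AroraBarakCC2009, proof of Thm. 9.17 p. 228] -/
theorem card_mul_hybCount_self [Fintype σ] [Inhabited σ] {D : ℕ} (q : Fin D → Bool) (hD : D < n) :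
    Fintype.card σ * hybCount g o T (nodeIdx D q) =
      ∑ ω : Sample σ n, #{s : σ | T (distFun g o ω (nodeIdx D q) fun b => g b s) = true} := by
  cases D with
  | zero =>
    -- node `i` is the root; its seed is the root label `ω.1`
    have key := card_rerandomize (Ω := Sample σ n) (S := σ) (fun ω => ω.1) (fun ω s => (s, ω.2))
      (fun ω s => rfl) (fun ω s s' => rfl) (fun ω => rfl)
      (fun ω s => T (distFun g o ω (nodeIdx 0 q) fun b => g b s)) (fun ω s s' => by
        show T (distFun g o (s, ω.2) (nodeIdx 0 q) fun b => g b s') =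
          T (distFun g o ω (nodeIdx 0 q) fun b => g b s')
        simp only [nodeIdx_zero]
        congr 1
        funext y
        simp only [distFun]
        obtain ⟨m, rfl⟩ : ∃ m, n = m + 1 := ⟨n - 1, by omega⟩
        exact congrArg o (distLab_root_congr _ m y))
    rw [← key.trans (card_filter_prod_eq_sum fun ω s =>
      T (distFun g o ω (nodeIdx 0 q) fun b => g b s))]
    congr 1
    simp only [hybCount]
    congr 1
    ext ω
    simp only [Finset.mem_filter, Finset.mem_univ, true_and]
    have : hybFun g o ω (nodeIdx 0 q) = distFun g o ω (nodeIdx 0 q) fun b => g b ω.1 := by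
      funext y
      simp only [hybFun, distFun]
      rw [hybLab_eq_distLab q n y]
      rfl
    rw [this]
  | succ D =>
    -- node `i = (D+1, q)`; its seed in hybrid `i` is the fresh label `ω.2 (parent) (q 0)`
    have hj : nodeIdx D (Fin.tail q) < 2 ^ n := by
      have h1 := nodeIdx_tail_lt q
      have h2 := nodeIdx_lt q
      have h3 : 2 ^ (D + 1 + 1) ≤ 2 ^ n := Nat.pow_le_pow_right (by norm_num) hD
      omega
    let a : Fin (2 ^ n) := ⟨nodeIdx D (Fin.tail q), hj⟩
    have key := card_rerandomize (Ω := Sample σ n) (S := σ) (fun ω => ω.2 a (q 0))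
      (fun ω s => (ω.1, Function.update ω.2 a (Function.update (ω.2 a) (q 0) s)))
      (fun ω s => by
        show Function.update ω.2 a (Function.update (ω.2 a) (q 0) s) a (q 0) = s
        rw [Function.update_self, Function.update_self])
      (fun ω s s' => by
        show (ω.1, Function.update (Function.update ω.2 a (Function.update (ω.2 a) (q 0) s)) a
            (Function.update ((Function.update ω.2 a (Function.update (ω.2 a) (q 0) s)) a)
              (q 0) s'))
          = (ω.1, Function.update ω.2 a (Function.update (ω.2 a) (q 0) s'))
        rw [Function.update_self, Function.update_idem, Function.update_idem])
      (fun ω => by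
        show (ω.1, Function.update ω.2 a (Function.update (ω.2 a) (q 0) (ω.2 a (q 0)))) = ω
        rw [Function.update_eq_self, Function.update_eq_self])
      (fun ω s => T (distFun g o ω (nodeIdx (D + 1) q) fun b => g b s)) (fun ω s s' => by
        show T (distFun g o (ω.1, Function.update ω.2 a (Function.update (ω.2 a) (q 0) s))
            (nodeIdx (D + 1) q) fun b => g b s') =
          T (distFun g o ω (nodeIdx (D + 1) q) fun b => g b s')
        congr 1
        funext y
        simp only [distFun]
        refine congrArg o (distLab_congr_seed q (fun j b hjb => ?_) _ n y (fun he => ?_))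
        · simp only [Sample.rho]
          split_ifs with h
          · by_cases hja : (⟨j, h⟩ : Fin (2 ^ n)) = a
            · rw [hja, Function.update_self]
              have hb : b ≠ q 0 := hjb.resolve_left (not_not.mpr (congrArg Fin.val hja))
              rw [Function.update_of_ne hb]
            · rw [Function.update_of_ne hja]
          · rfl
        · exact absurd (depth_eq_of_nodeIdx_eq he) (by omega))
    rw [← key.trans (card_filter_prod_eq_sum fun ω s =>
      T (distFun g o ω (nodeIdx (D + 1) q) fun b => g b s))]
    congr 1
    simp only [hybCount]
    congr 1
    ext ω
    simp only [Finset.mem_filter, Finset.mem_univ, true_and]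
    have : hybFun g o ω (nodeIdx (D + 1) q) =
        distFun g o ω (nodeIdx (D + 1) q) fun b => g b (ω.2 a (q 0)) := by
      funext y
      simp only [hybFun, distFun]
      rw [hybLab_eq_distLab q n y, hybLab_of_lt q (nodeIdx_tail_lt q), Sample.rho_of_lt ω hj]
    rw [this]

/-! #### Telescoping and averaging: some hybrid step, at some sample, distinguishes -/

/-- **The hybrid lemma** (Razborov–Rudich 1997, proof of Thm. 4.1; Müller–Pich 2020, Claim 3.28;
Arora–Barak 2009, p. 228: "`E_{i ∈ [Tn]}[pᵢ - pᵢ₋₁] ≥ ε/(Tn)`"). If the test `T` rejects every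
GGM function `y ↦ o (ggmLab g x (m+1) y)` but accepts at least `B · 2^{2^{m+1}}` Boolean
functions, then for some internal node `i < 2^{m+1} - 1` and some fixing `ω` of all fresh labels,
the distinguisher tree at `i` accepts a uniform challenge `z : Bool → σ` with probability at least
`B / (2^{m+1} - 1)` more than the pseudo-random challenge `z = (g 0 s, g 1 s)`, `s ∈ σ` uniform.
Here `flip` is any involution of `σ` negating the readout `o` (used for the uniformity of the last
hybrid). [cite: MullerPich2020, §3.6 Claim 3.28 p. 27] -/
theorem exists_distinguisher [Fintype σ] [Inhabited σ] {flip : σ → σ} (ho : ∀ s, o (flip s) = !o s)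
    (hflip : ∀ s, flip (flip s) = s) (T : ((Fin (m + 1) → Bool) → Bool) → Bool)
    (hA : ∀ x : σ, T (fun y => o (ggmLab g x (m + 1) y)) = false) {B : ℝ}
    (hB : B * 2 ^ 2 ^ (m + 1) ≤ #{h : (Fin (m + 1) → Bool) → Bool | T h = true}) :
    ∃ (i : ℕ) (ω : Sample σ (m + 1)), i < 2 ^ (m + 1) - 1 ∧
      B / (2 ^ (m + 1) - 1 : ℕ) ≤
        (#{z : Bool → σ | T (distFun g o ω i z) = true} : ℝ) / Fintype.card (Bool → σ) -
        (#{s : σ | T (distFun g o ω i fun b => g b s) = true} : ℝ) / Fintype.card σ := by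
  set N : ℕ := 2 ^ (m + 1) - 1 with hN
  have hN1 : 1 ≤ N := by
    have : 2 ≤ 2 ^ (m + 1) := by
      calc (2 : ℕ) = 2 ^ 1 := by norm_num
        _ ≤ 2 ^ (m + 1) := Nat.pow_le_pow_right (by norm_num) (by omega)
    omega
  have hNlt : N < 2 ^ (m + 1) := by have : 1 ≤ 2 ^ (m + 1) := Nat.one_le_two_pow; omega
  set Ωc : ℝ := (Fintype.card (Sample σ (m + 1)) : ℝ) with hΩc
  have hΩpos : 0 < Ωc := by rw [hΩc]; exact_mod_cast Fintype.card_pos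
  -- densities of the hybrids
  set p : ℕ → ℝ := fun i => (hybCount g o T i : ℝ) / Ωc with hp
  have hp0 : p 0 = 0 := by simp [hp, hybCount_zero hA]
  have hpN : B ≤ p N := by
    have h := hybCount_last_mul (g := g) ho hflip T
    rw [hp]
    simp only
    rw [le_div_iff₀ hΩpos]
    have h' : (hybCount g o T N : ℝ) * 2 ^ 2 ^ (m + 1) =
        Ωc * #{h : (Fin (m + 1) → Bool) → Bool | T h = true} := by
      rw [hΩc, hN]; exact_mod_cast h
    nlinarith [hB, h', hΩpos, show (0 : ℝ) < 2 ^ 2 ^ (m + 1) from by positivity]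
  -- telescoping: some step gains at least `B / N`
  obtain ⟨i, hi, hstep⟩ : ∃ i ∈ Finset.range N, B / N ≤ p (i + 1) - p i := by
    apply Finset.exists_le_of_sum_le (Finset.nonempty_range_iff.mpr (by omega))
    rw [Finset.sum_range_sub, Finset.sum_const, Finset.card_range, nsmul_eq_mul, hp0, sub_zero]
    have hNr : (N : ℝ) ≠ 0 := by exact_mod_cast (show N ≠ 0 by omega)
    rw [mul_div_cancel₀ _ hNr]
    exact hpN
  rw [Finset.mem_range] at hi
  -- node `i = (D, q)`
  have hD : depthOf i < m + 1 := depthOf_lt_of_lt hi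
  have h1 := card_mul_hybCount_succ (g := g) (o := o) (T := T) (hi.trans hNlt)
  have h2 := card_mul_hybCount_self (g := g) (o := o) (T := T) (pathOf i) hD
  rw [nodeIdx_pathOf] at h2
  -- rewrite the step gain as an average over samples
  have hcBS : (0 : ℝ) < Fintype.card (Bool → σ) := by exact_mod_cast Fintype.card_pos
  have hcσ : (0 : ℝ) < Fintype.card σ := by exact_mod_cast Fintype.card_pos
  have e1 : (hybCount g o T (i + 1) : ℝ) =
      (∑ ω : Sample σ (m + 1), (#{z : Bool → σ | T (distFun g o ω i z) = true} : ℝ)) /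
        Fintype.card (Bool → σ) := by
    rw [eq_div_iff hcBS.ne', mul_comm]; exact_mod_cast h1
  have e2 : (hybCount g o T i : ℝ) =
      (∑ ω : Sample σ (m + 1), (#{s : σ | T (distFun g o ω i fun b => g b s) = true} : ℝ)) /
        Fintype.card σ := by
    rw [eq_div_iff hcσ.ne', mul_comm]; exact_mod_cast h2
  set F : Sample σ (m + 1) → ℝ := fun ω =>
    (#{z : Bool → σ | T (distFun g o ω i z) = true} : ℝ) / Fintype.card (Bool → σ) -
      (#{s : σ | T (distFun g o ω i fun b => g b s) = true} : ℝ) / Fintype.card σ with hF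
  have hdiff : p (i + 1) - p i = (∑ ω, F ω) / Ωc := by
    have : p (i + 1) - p i = ((hybCount g o T (i + 1) : ℝ) - hybCount g o T i) / Ωc := by
      simp only [hp]; ring
    rw [this, e1, e2, hF, Finset.sum_sub_distrib, Finset.sum_div, Finset.sum_div]
  rw [hdiff, le_div_iff₀ hΩpos] at hstep
  have hstep' : ∑ _ω : Sample σ (m + 1), B / N ≤ ∑ ω, F ω := by
    rw [Finset.sum_const, Finset.card_univ, nsmul_eq_mul, ← hΩc]
    linarith
  obtain ⟨ω, -, hω⟩ := Finset.exists_le_of_sum_le Finset.univ_nonempty hstep'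
  exact ⟨i, ω, hi, hω⟩

end Hybrid

/-! ### Circuits for the GGM function and for the distinguisher -/

section Circuits

variable {k : ℕ} (g : Bool → (Fin k → Bool) → (Fin k → Bool)) {sb : ℕ}

/-- Applying `g b` with the bit `b` read off a wire costs `2 k sb + 4 k` gates: two copies of
`g` and one multiplexer per output bit. [folklore] -/
theorem cktSize_muxApply
    (hg : ∀ (b : Bool) (i : Fin k), CktSize B2 (fun s (_ : Unit) => g b s i) sb) :
    CktSize B2 (fun (w : Unit ⊕ Fin k → Bool) (i : Fin k) =>
      g (w (Sum.inl ())) (fun j => w (Sum.inr j)) i) (2 * (k * sb) + k * 4) := by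
  have hgk : ∀ b : Bool, CktSize B2 (fun (w : Unit ⊕ Fin k → Bool) (i : Fin k) =>
      g b (fun j => w (Sum.inr j)) i) (k * sb) := fun b => by
    have := (CktSize.pi_const fun i => hg b i).rewire (ι' := Unit ⊕ Fin k) Sum.inr
    simpa using this
  have h1 : CktSize B2 (fun (w : Unit ⊕ Fin k → Bool) =>
      Sum.elim w (Sum.elim (fun i => g true (fun j => w (Sum.inr j)) i)
        (fun i => g false (fun j => w (Sum.inr j)) i))) (0 + (k * sb + k * sb)) :=
    (CktSize.id B2).pair ((hgk true).pair (hgk false))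
  have h2 : CktSize B2 (fun (u : (Unit ⊕ Fin k) ⊕ (Fin k ⊕ Fin k) → Bool) (i : Fin k) =>
      (u (Sum.inl (Sum.inl ())) && u (Sum.inr (Sum.inl i)) ||
        !u (Sum.inl (Sum.inl ())) && u (Sum.inr (Sum.inr i)))) (k * 4) := by
    have := CktSize.pi_const (B := B2) (κ := Fin k) fun i =>
      cktSize_mux (ι := (Unit ⊕ Fin k) ⊕ (Fin k ⊕ Fin k)) (Sum.inl (Sum.inl ()))
        (Sum.inr (Sum.inl i)) (Sum.inr (Sum.inr i))
    simpa using this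
  refine ((h1.comp h2).of_le (by omega)).congr fun w i => ?_
  simp only [Sum.elim_inl, Sum.elim_inr]
  cases w (Sum.inl ()) <;> simp

/-- **The GGM function has small circuits**: `y ↦ G_y(x)` (all `k` label bits of leaf `y`, the
seed `x` on input wires) costs `n (2 k sb + 4 k)` gates (Arora–Barak 2009, p. 227: "`f_k(x)` can
be computed by making `n` invocations of `G`"; Müller–Pich 2020, p. 27, eq. (31)).
[cite: AroraBarakCC2009, Thm. 9.17 p. 227] -/
theorem cktSize_ggmLab
    (hg : ∀ (b : Bool) (i : Fin k), CktSize B2 (fun s (_ : Unit) => g b s i) sb) :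
    ∀ n : ℕ, CktSize B2 (fun (w : Fin n ⊕ Fin k → Bool) (i : Fin k) =>
      ggmLab g (fun j => w (Sum.inr j)) n (fun t => w (Sum.inl t)) i) (n * (2 * (k * sb) + k * 4))
  | 0 => by simpa using CktSize.proj B2 (ι := Fin 0 ⊕ Fin k) (κ := Fin k) Sum.inr
  | n + 1 => by
    have ih := (cktSize_ggmLab hg n).rewire (ι' := Fin (n + 1) ⊕ Fin k)
      (Sum.elim (fun t => Sum.inl t.succ) Sum.inr)
    have h1 := (CktSize.proj B2 (ι := Fin (n + 1) ⊕ Fin k) fun _ : Unit => Sum.inl 0).pair ih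
    have h2 := h1.comp (cktSize_muxApply g hg)
    refine (h2.of_le (by ring_nf; omega)).congr fun w i => ?_
    simp only [Sum.elim_inl, Sum.elim_inr, ggmLab_succ]
    rfl

/-- The GGM function `f_x` with the seed `x` hard-wired and one output bit `j₀` read costs
`n (2 k sb + 4 k) + 2` gates (Arora–Barak 2009, p. 592: "computable by circuit of size `poly(m)`
that has `s` hard-wired into it"). [cite: AroraBarakCC2009, §23.3 p. 592] -/
theorem cktSize_ggmFun (hg : ∀ (b : Bool) (i : Fin k), CktSize B2 (fun s (_ : Unit) => g b s i) sb)
    (x : Fin k → Bool) (j₀ : Fin k) (n : ℕ) :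
    CktSize B2 (fun (y : Fin n → Bool) (_ : Unit) => ggmLab g x n y j₀)
      (n * (2 * (k * sb) + k * 4) + 2) := by
  have h := ((cktSize_ggmLab g hg n).outMap fun _ : Unit => j₀).hardwire x
  exact h.congr fun y _ => rfl

/-- Hence the circuit complexity of `f_x = (ggmLab g x n · j₀)` is at most `n (2 k sb + 4 k) + 2`
(Arora–Barak 2009, p. 592). [cite: AroraBarakCC2009, §23.3 p. 592] -/
theorem circuitSizeOver_ggm_le
    (hg : ∀ (b : Bool) (i : Fin k), CktSize B2 (fun s (_ : Unit) => g b s i) sb)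
    (x : Fin k → Bool) (j₀ : Fin k) (n : ℕ) :
    circuitSizeOver B2 (fun y : Fin n → Bool => ggmLab g x n y j₀) ≤
      n * (2 * (k * sb) + k * 4) + 2 := by
  obtain ⟨C, hC, hs, he⟩ := (cktSize_ggmFun g hg x j₀ n).toCircuit
  exact (circuitSizeOver_le_of_computes C hC he).trans hs

/-! #### The distinguisher circuit -/

variable (ρ : ℕ → Bool → (Fin k → Bool)) (x : Fin k → Bool) (i : ℕ)

/-- Gate count of the level-by-level circuit for the distinguisher tree of depth `d`: `k` wires
for the root and `2 ^ (d+1) k (sb + 1)` for level `d + 1`. [folklore] -/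
def distSize (k sb : ℕ) : ℕ → ℕ
  | 0 => k
  | d + 1 => distSize k sb d + 2 ^ (d + 1) * k * (sb + 1)

/-- `distSize k sb d + 2 k (sb + 1) ≤ k + 2 ^ (d+1) k (sb + 1)` (geometric sum). [folklore] -/
theorem distSize_le (k sb : ℕ) :
    ∀ d, distSize k sb d + 2 * k * (sb + 1) ≤ k + 2 ^ (d + 1) * k * (sb + 1)
  | 0 => by simp [distSize]
  | d + 1 => by
    have := distSize_le k sb d
    simp only [distSize, pow_succ] at this ⊢
    nlinarith

/-- Level `d` of the distinguisher circuit: the challenge wires together with the labels of all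
depth-`d` nodes of the distinguisher tree, as functions of the challenge `z` on `Bool × Fin k`
input wires, in `distSize k sb d` gates (Müller–Pich 2020, p. 27: "the function
`b₀ ↦ G_{b₀,b₁ j}` can be computed by circuits of size `2^{em}`").
[cite: MullerPich2020, §3.6 proof of Thm. 3.27 p. 27] -/
theorem cktSize_distLab
    (hg : ∀ (b : Bool) (i : Fin k), CktSize B2 (fun s (_ : Unit) => g b s i) sb) :
    ∀ d : ℕ, CktSize B2
      (fun (z : Bool × Fin k → Bool) (w : (Bool × Fin k) ⊕ ((Fin d → Bool) × Fin k)) =>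
        Sum.elim z (fun pj => distLab g ρ x i (fun b j => z (b, j)) d pj.1 pj.2) w)
      (distSize k sb d)
  | 0 => by
    have := (CktSize.id B2 (ι := Bool × Fin k)).pair
      (CktSize.pi_const (κ := (Fin 0 → Bool) × Fin k) fun pj =>
        cktSize_const (Bool × Fin k) (x pj.2))
    simpa [distSize] using this
  | d + 1 => by
    -- one node step, per output bit `(p, j)` of level `d + 1`
    have hstep : ∀ pj : (Fin (d + 1) → Bool) × Fin k,
        CktSize B2 (fun (u : (Bool × Fin k) ⊕ ((Fin d → Bool) × Fin k) → Bool) (_ : Unit) =>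
          if nodeIdx d (Fin.tail pj.1) < i then ρ (nodeIdx d (Fin.tail pj.1)) (pj.1 0) pj.2
          else if nodeIdx d (Fin.tail pj.1) = i then u (Sum.inl (pj.1 0, pj.2))
          else g (pj.1 0) (fun j' => u (Sum.inr (Fin.tail pj.1, j'))) pj.2) (sb + 1) := by
      rintro ⟨p, j⟩
      by_cases h1 : nodeIdx d (Fin.tail p) < i
      · simp only [h1, ↓reduceIte]
        exact (cktSize_const _ _).of_le (by omega)
      · simp only [h1, ↓reduceIte]
        by_cases h2 : nodeIdx d (Fin.tail p) = i
        · simp only [h2, ↓reduceIte]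
          exact (CktSize.proj B2 fun _ : Unit => Sum.inl (p 0, j)).of_le (by omega)
        · simp only [h2, ↓reduceIte]
          exact ((hg (p 0) j).rewire fun j' => Sum.inr (Fin.tail p, j')).of_le (by omega)
    have hΛ := (CktSize.proj B2 (ι := (Bool × Fin k) ⊕ ((Fin d → Bool) × Fin k))
      (κ := Bool × Fin k) Sum.inl).pair (CktSize.pi_const hstep)
    have h := (cktSize_distLab hg d).comp hΛ
    refine (h.of_le ?_).congr fun z w => ?_
    · simp only [distSize, Fintype.card_prod, Fintype.card_fun, Fintype.card_bool, Fintype.card_fin]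
      ring_nf
      omega
    · cases w with
      | inl bj => simp
      | inr pj =>
        obtain ⟨p, j⟩ := pj
        simp only [Sum.elim_inr, Sum.elim_inl, distLab_succ]
        split_ifs <;> rfl

/-- **The distinguisher has circuits of size `2^{O(n)}`**: with the challenge `z` on the
`Bool × Fin k` input wires, the distinguisher tree computed level by level, bit `j₀` of every
leaf label read off and fed to the test circuit `Tc` on `2 ^ n` inputs, the map
`z ↦ Tc (truth table)` costs `k + 2 ^ (n+1) k (sb + 1) + |Tc|` gates (Müller–Pich 2020, p. 27:
"the events in (34) are defined by circuits of size `2^{em+1}`"; Razborov–Rudich 1997, proof of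
Thm. 4.1). [cite: MullerPich2020, §3.6 proof of Thm. 3.27 p. 27] -/
theorem cktSize_distTest
    (hg : ∀ (b : Bool) (i : Fin k), CktSize B2 (fun s (_ : Unit) => g b s i) sb)
    (j₀ : Fin k) (n : ℕ) (Tc : Circuit (Fin (2 ^ n))) (hTc : Tc.IsOver B2) :
    CktSize B2 (fun (z : Bool × Fin k → Bool) (_ : Unit) =>
      Tc.eval fun t => distLab g ρ x i (fun b j => z (b, j)) n ((boolFunEquivFin n).symm t) j₀)
      (k + 2 ^ (n + 1) * k * (sb + 1) + Tc.size) := by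
  have hT := (Tc.cktSize_eval hTc).rewire (ι' := (Bool × Fin k) ⊕ ((Fin n → Bool) × Fin k))
    fun t => Sum.inr ((boolFunEquivFin n).symm t, j₀)
  have h := (cktSize_distLab g ρ x i hg n).comp hT
  refine (h.of_le ?_).congr fun z _ => rfl
  have := distSize_le k sb n
  omega

end Circuits

/-! ### The distinguisher bounds the hardness of the generator -/

section Hardness

/-- The two halves of `{0,1}^{2k}`: `(b, j) ↦` position `j` of half `b` (`b = false` the first
`k` bits, `b = true` the last `k` bits; Arora–Barak 2009, p. 227: "`G₀(x)` the first `n` bits of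
`G(x)`, `G₁(x)` the last `n` bits"). [cite: AroraBarakCC2009, proof of Thm. 9.17 p. 227] -/
def halfEquiv (k : ℕ) : Bool × Fin k ≃ Fin (2 * k) :=
  (Equiv.prodCongr finTwoEquiv.symm (Equiv.refl (Fin k))).trans finProdFinEquiv

/-- Splitting a `2k`-bit string into its two `k`-bit halves. [folklore] -/
def splitEquiv (k : ℕ) : (Fin (2 * k) → Bool) ≃ (Bool → Fin k → Bool) :=
  ((halfEquiv k).symm.arrowCongr (Equiv.refl Bool)).trans (Equiv.curry Bool (Fin k) Bool)

/-- `splitEquiv` reads position `halfEquiv k (b, j)`. [folklore] -/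
@[simp] theorem splitEquiv_apply (k : ℕ) (w : Fin (2 * k) → Bool) (b : Bool) (j : Fin k) :
    splitEquiv k w b j = w (halfEquiv k (b, j)) := rfl

/-- A generator `G₂ : {0,1}ᵏ → {0,1}²ᵏ` as the pair of maps `G_b : {0,1}ᵏ → {0,1}ᵏ` (its two
halves), the step functions of the GGM tree (Arora–Barak 2009, p. 227).
[cite: AroraBarakCC2009, proof of Thm. 9.17 p. 227] -/
def halfGen {k : ℕ} (G₂ : (Fin k → Bool) → (Fin (2 * k) → Bool)) (b : Bool) (s : Fin k → Bool) :
    Fin k → Bool := fun j => G₂ s (halfEquiv k (b, j))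

/-- **Razborov–Rudich 1997, proof of Thm. 4.1 (finite core; Müller–Pich 2020, Thm. 3.27 with
Claim 3.28).** Let `G₂ : {0,1}ᵏ⁺¹ → {0,1}^{2(k+1)}` have `B₂`-circuits of size `≤ sb` per output
bit, and let `Tc` be a `B₂`-circuit on `2^{m+1}` inputs (a test on truth tables of
`(m+1)`-variable functions) that rejects the truth table of every GGM function
`y ↦ bit₀ (G_y(x))`, `x ∈ {0,1}ᵏ⁺¹`, and accepts at least `B · 2^{2^{m+1}}` truth tables. Then
`H(G₂) ≤ S` for every `S ≥ (k+1) + 2^{m+2} (k+1) (sb+1) + |Tc|` with `1/S ≤ B / (2^{m+1} - 1)`: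
the distinguisher circuit of `cktSize_distTest` at the node and sample provided by
`exists_distinguisher` has size `≤ S` and advantage `≥ B / (2^{m+1} - 1) ≥ 1/S` against `G₂`.
[cite: RazborovRudich1997, Thm. 4.1 proof] -/
theorem prgHardness_le_of_test {k m sb : ℕ} (G₂ : (Fin (k + 1) → Bool) → (Fin (2 * (k + 1)) → Bool))
    (hG : ∀ i, CktSize B2 (fun s (_ : Unit) => G₂ s i) sb)
    (Tc : Circuit (Fin (2 ^ (m + 1)))) (hTc : Tc.IsOver B2)
    (hU : ∀ x : Fin (k + 1) → Bool,
      Tc.eval (fun t => ggmLab (halfGen G₂) x (m + 1) ((boolFunEquivFin (m + 1)).symm t) 0) = false)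
    {B : ℝ} (hB : B * 2 ^ 2 ^ (m + 1) ≤
      #{h : (Fin (m + 1) → Bool) → Bool |
        Tc.eval (fun t => h ((boolFunEquivFin (m + 1)).symm t)) = true})
    {S : ℕ} (hS : (k + 1) + 2 ^ (m + 1 + 1) * (k + 1) * (sb + 1) + Tc.size ≤ S)
    (hSB : (1 : ℝ) / S ≤ B / (2 ^ (m + 1) - 1 : ℕ)) :
    prgHardness G₂ ≤ S := by
  -- the hybrid lemma
  set g := halfGen G₂ with hg_def
  set o : (Fin (k + 1) → Bool) → Bool := fun s => s 0 with ho_def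
  set T : ((Fin (m + 1) → Bool) → Bool) → Bool :=
    fun h => Tc.eval fun t => h ((boolFunEquivFin (m + 1)).symm t) with hT_def
  obtain ⟨i, ω, hi, hadv⟩ := exists_distinguisher (g := g) (o := o)
    (flip := fun s => Function.update s 0 (!s 0)) (fun s => by simp [ho_def])
    (fun s => by ext j; by_cases hj : j = 0 <;> simp [hj]) T (fun x => hU x) hB
  -- the distinguisher circuit
  have hg : ∀ (b : Bool) (j : Fin (k + 1)), CktSize B2 (fun s (_ : Unit) => g b s j) sb :=
    fun b j => hG (halfEquiv (k + 1) (b, j))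
  have hck := (cktSize_distTest g ω.rho ω.1 i hg 0 (m + 1) Tc hTc).rewire
    (ι' := Fin (2 * (k + 1))) (halfEquiv (k + 1))
  obtain ⟨C, hC, hCs, hCe⟩ := hck.toCircuit
  have hSpos : 0 < S := by
    have : 0 < k + 1 := Nat.succ_pos k
    omega
  refine prgHardness_le hSpos C hC (hCs.trans hS) (hSB.trans (hadv.trans ?_))
  -- its advantage is the hybrid gap
  have hcσ : (Fintype.card (Fin (k + 1) → Bool) : ℝ) = 2 ^ (k + 1) := by simp
  have hcB : (Fintype.card (Bool → Fin (k + 1) → Bool) : ℝ) = 2 ^ (2 * (k + 1)) := by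
    rw [Fintype.card_fun, Fintype.card_bool, Fintype.card_fun, Fintype.card_bool, Fintype.card_fin]
    push_cast
    rw [← pow_mul, mul_comm]
  have e1 : #{s : Fin (k + 1) → Bool | C.eval (G₂ s) = true} =
      #{s : Fin (k + 1) → Bool | T (distFun g o ω i fun b => g b s) = true} := by
    congr 1
    ext s
    simp only [Finset.mem_filter, Finset.mem_univ, true_and, hCe]
    rfl
  have e2 : #{w : Fin (2 * (k + 1)) → Bool | C.eval w = true} =
      #{z : Bool → Fin (k + 1) → Bool | T (distFun g o ω i z) = true} := by
    refine card_equiv (splitEquiv (k + 1)) fun w => ?_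
    simp only [Finset.mem_filter, Finset.mem_univ, true_and, hCe]
    have : splitEquiv (k + 1) w = fun b j => w (halfEquiv (k + 1) (b, j)) := rfl
    rw [this]
    rfl
  rw [prgAdvantage, e1, e2, ← hcσ, ← hcB, abs_sub_comm]
  exact le_abs_self _

end Hardness

end Literature.Computability.MetaComplexity
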